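import Literature.Computability.AlgebraicComplexity.OrbitAveragingCircuit
import Mathlib.Data.Fintype.Perm
import Mathlib.Data.Nat.Factorial.Basic
import HarnessLib

/-!
# Symmetrization by orbit averaging: semantics and the symmetrization theorems

Continuation of `OrbitAveragingCircuit.lean`. The gate `node γ p` of the orbit-averaging circuit
of `C` computes `rename γ (valueAt C p)` (`PICircuit.eval_oa_node`, by strong induction along the
node list using the value recursion `PICircuit.valueAt_eq` of `PICircuitNodeValues.lean`), the
averaging gate computes `Σ_γ Ĉ^γ = |Γ| · Ĉ` for a `Γ`-invariant `Ĉ`, and the output computes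
`Ĉ` when `|Γ| · u = 1`. Consequences:

* `PICircuit.exists_isSymmetric_of_rename_eval_eq` — **symmetrization by orbit averaging**: a
  finite group `Γ` acting on finitely many variables `X`, `|Γ|` invertible in the constants, `Ĉ`
  `Γ`-invariant ⟹ a `Γ`-symmetric labelled circuit (DW Def. 3.7) computes `Ĉ` in size
  `≤ |X| + (2|Γ| + 1)|C| + 5`;
* `PICircuit.exists_isSymmetric_perm_of_rename_eval_eq` — the case `Γ = S_n` acting diagonally
  on the matrix variables `Fin n × Fin n` over a field of characteristic `0`: size
  `≤ n² + (2·n! + 1)|C| + 5` (square-symmetric circuits in Dawar–Wilsenach's terminology).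

Folklore; everything proved. For route ProofCarryingSymmetry this is the `n!`-cost baseline: its
items `RestorationQP` / `StabilityOfProvableSymmetry` assert bounds UNIFORM in `n`, and for each
fixed `n` (in particular `n ≤ 1`, where their proof hypotheses are vacuous) they follow from here.
-/

noncomputable section

namespace Literature.Computability.AlgebraicComplexity

open MvPolynomial

universe u v w

namespace PICircuit

variable {𝔽 : Type u} {X : Type v} {Γ : Type w} [Group Γ] [MulAction Γ X]

section Eval

variable [CommSemiring 𝔽] [DecidableEq 𝔽] [DecidableEq X] [DecidableEq Γ] [Fintype Γ]
  (C : PICircuit 𝔽 X) (u : 𝔽)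

/-- Input gates compute their variable. [folklore] -/
theorem eval_oa_inp (x : X) :
    (C.orbitAvgCircuit Γ u).eval (.inp x) = MvPolynomial.X x :=
  (C.orbitAvgCircuit Γ u).eval_of_label_var rfl

/-- Constant gates compute their constant. [folklore] -/
theorem eval_oa_cst (c : C.constSet u) :
    (C.orbitAvgCircuit Γ u).eval (.cst c) = MvPolynomial.C c.val :=
  (C.orbitAvgCircuit Γ u).eval_of_label_const rfl

/-- `cgate c` computes `c` for constants of `C`. [folklore] -/
theorem eval_oa_cgate {c : 𝔽} (h : c ∈ C.constSet u) :
    (C.orbitAvgCircuit Γ u).eval (C.cgate Γ u c) = MvPolynomial.C c := by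
  rw [C.cgate_eq_of_mem u h, eval_oa_cst]

/-- `zero'` computes `0`. [folklore] -/
theorem eval_oa_zero' : (C.orbitAvgCircuit Γ u).eval .zero' = 0 := by
  rw [(C.orbitAvgCircuit Γ u).eval_of_label_add (g := .zero') rfl,
    show (C.orbitAvgCircuit Γ u).children .zero' =
      {(.cst ⟨0, C.zero_mem_constSet u⟩ : C.OAGate Γ u)} from rfl,
    Finset.sum_singleton, eval_oa_cst]
  exact map_zero _

/-- `copy γ p` computes the same as `node γ p`. [folklore] -/
theorem eval_oa_copy (γ : Γ) (p : Fin C.size) :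
    (C.orbitAvgCircuit Γ u).eval (.copy γ p) = (C.orbitAvgCircuit Γ u).eval (.node γ p) := by
  rw [(C.orbitAvgCircuit Γ u).eval_of_label_add (g := .copy γ p) rfl,
    show (C.orbitAvgCircuit Γ u).children (.copy γ p) = {(.node γ p : C.OAGate Γ u)} from rfl,
    Finset.sum_singleton]

/-- **The copies compute the relabelled node values**: `node γ p` computes the value of node `p`
of `C` with the variables renamed by `γ`. [folklore] -/
theorem eval_oa_node (γ : Γ) (p : Fin C.size) :
    (C.orbitAvgCircuit Γ u).eval (.node γ p) =
      MvPolynomial.rename (fun x : X => γ • x) (C.valueAt p) := by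
  obtain ⟨p, hp⟩ := p
  induction p using Nat.strong_induction_on with
  | _ p ih =>
    have hl : ∀ i, (C.orbitAvgCircuit Γ u).eval (C.lchild u γ ⟨p, hp⟩ i) =
        MvPolynomial.rename (fun x : X => γ • x) (C.childValue p i) := by
      intro i
      unfold lchild childValue
      split_ifs with h
      · exact ih i h (h.trans hp)
      · rw [eval_oa_cst, map_zero, map_zero]
    have hr : ∀ j, (C.orbitAvgCircuit Γ u).eval (C.rchild u γ ⟨p, hp⟩ j) =
        MvPolynomial.rename (fun x : X => γ • x) (C.childValue p j) := by
      intro j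
      unfold rchild childValue
      split_ifs with h
      · rw [eval_oa_copy]; exact ih j h (h.trans hp)
      · rw [eval_oa_zero', map_zero]
    have hlab : (C.orbitAvgCircuit Γ u).label (.node γ ⟨p, hp⟩) = nodeLabel (C.nodeAt p) := rfl
    have hch : (C.orbitAvgCircuit Γ u).children (.node γ ⟨p, hp⟩) =
        C.nodeChildren u γ ⟨p, hp⟩ (C.nodeAt p) := rfl
    rw [C.valueAt_eq hp]
    cases hnd : C.nodeAt p with
    | var x =>
      rw [hnd] at hlab hch
      rw [(C.orbitAvgCircuit Γ u).eval_of_label_add hlab, hch]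
      simp [nodeChildren, eval_oa_inp, Node.evalWith]
    | const c =>
      rw [hnd] at hlab hch
      rw [(C.orbitAvgCircuit Γ u).eval_of_label_add hlab, hch]
      simp only [nodeChildren, Finset.sum_singleton, Node.evalWith, MvPolynomial.rename_C]
      exact C.eval_oa_cgate u (C.mem_constSet_of_nodeAt u hnd)
    | add i j =>
      rw [hnd] at hlab hch
      rw [(C.orbitAvgCircuit Γ u).eval_of_label_add hlab, hch]
      simp only [nodeChildren]
      rw [Finset.sum_pair (C.lchild_ne_rchild u γ _ i j), hl, hr]
      simp [Node.evalWith, Node.left, Node.right]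
    | mul i j =>
      rw [hnd] at hlab hch
      rw [(C.orbitAvgCircuit Γ u).eval_of_label_mul hlab, hch]
      simp only [nodeChildren]
      rw [Finset.prod_pair (C.lchild_ne_rchild u γ _ i j), hl, hr]
      simp [Node.evalWith, Node.left, Node.right]

/-- The last copies compute the relabellings `Ĉ^γ` of the polynomial of `C`. [folklore] -/
theorem eval_oa_node_lastFin (γ : Γ) :
    (C.orbitAvgCircuit Γ u).eval (.node γ C.lastFin) =
      MvPolynomial.rename (fun x : X => γ • x) C.eval := by
  rw [eval_oa_node, show (C.lastFin : ℕ) = C.size - 1 from rfl, valueAt_size_sub_one]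

/-- For a `Γ`-invariant `Ĉ`, the averaging gate computes `|Γ| · Ĉ`. [folklore] -/
theorem eval_oa_avg (hC : ∀ γ : Γ, MvPolynomial.rename (fun x : X => γ • x) C.eval = C.eval) :
    (C.orbitAvgCircuit Γ u).eval .avg = Fintype.card Γ • C.eval := by
  rw [(C.orbitAvgCircuit Γ u).eval_of_label_add (g := .avg) rfl,
    show (C.orbitAvgCircuit Γ u).children .avg =
      Finset.univ.image (fun γ : Γ => (.node γ C.lastFin : C.OAGate Γ u)) from rfl,
    Finset.sum_image (fun γ _ γ' _ h => by simpa using h)]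
  simp_rw [eval_oa_node_lastFin, hC]
  rw [Finset.sum_const, Finset.card_univ]

/-- **The orbit-averaging circuit computes `Ĉ`** when `Ĉ` is `Γ`-invariant and `|Γ| · u = 1`.
[folklore] -/
theorem eval_oa_out (hu : (Fintype.card Γ : 𝔽) * u = 1)
    (hC : ∀ γ : Γ, MvPolynomial.rename (fun x : X => γ • x) C.eval = C.eval) :
    (C.orbitAvgCircuit Γ u).eval ((C.orbitAvgCircuit Γ u).output ()) = C.eval := by
  rw [show (C.orbitAvgCircuit Γ u).output () = .out from rfl,
    (C.orbitAvgCircuit Γ u).eval_of_label_mul (g := .out) rfl,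
    show (C.orbitAvgCircuit Γ u).children .out =
      {(.avg : C.OAGate Γ u), .cst ⟨u, C.mem_constSet_self u⟩} from rfl,
    Finset.prod_pair (by simp), C.eval_oa_avg u hC, eval_oa_cst]
  rw [nsmul_eq_mul, ← map_natCast (MvPolynomial.C : 𝔽 →+* MvPolynomial X 𝔽), mul_right_comm,
    ← map_mul, hu, map_one, one_mul]

end Eval

/-- **Symmetrization by orbit averaging.** Let a finite group `Γ` act on the variables `X`
(finite), and let `C` be a Hrubeš–Tzameret straight-line circuit whose polynomial `Ĉ` is
`Γ`-invariant, over constants in which `|Γ|` has an inverse `u`. Then `Ĉ` is computed by a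
`Γ`-SYMMETRIC labelled arithmetic circuit (Dawar–Wilsenach Defs. 2.2, 3.7) of size at most
`|X| + (2|Γ| + 1)·|C| + 5` — the `|Γ|` relabelled copies of `C`, averaged. For `Γ = S_n` this is
the trivial `n!`-cost restoration of symmetry; any uniform-in-`n` polynomial bound (route
ProofCarryingSymmetry: `RestorationQP`, `StabilityOfProvableSymmetry`) must beat it. [folklore] -/
theorem exists_isSymmetric_of_rename_eval_eq {𝔽 : Type u} [CommSemiring 𝔽] {X : Type v}
    [Fintype X] {Γ : Type w} [Group Γ] [Fintype Γ] [MulAction Γ X]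
    (C : PICircuit 𝔽 X) (u : 𝔽) (hu : (Fintype.card Γ : 𝔽) * u = 1)
    (hC : ∀ γ : Γ, MvPolynomial.rename (fun x : X => γ • x) C.eval = C.eval) :
    ∃ (G : Type (max u v w)) (_ : Fintype G) (D : LabelledArithCircuit 𝔽 X Unit G),
      D.IsSymmetric Γ ∧ D.eval (D.output ()) = C.eval ∧
      Fintype.card G ≤ Fintype.card X + (2 * Fintype.card Γ + 1) * C.size + 5 := by
  classical
  exact ⟨C.OAGate Γ u, inferInstance, (C.orbitAvgCircuit Γ u).toLabelledArithCircuit,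
    (C.orbitAvgCircuit Γ u).isSymmetric, C.eval_oa_out u hu hC, C.card_oaGate_le u⟩

/-- **Orbit averaging over `S_n`.** A Hrubeš–Tzameret circuit `C` over a field of characteristic
`0` in the matrix variables `x_ij` (`i, j < n`) whose polynomial is invariant under the diagonal
relabelling `x_ij ↦ x_{σ i, σ j}` of `S_n` is computed by an `S_n`-symmetric labelled circuit
(square-symmetric in Dawar–Wilsenach's terminology) of size at most `n² + (2·n! + 1)·|C| + 5`.
This is the trivial, `n!`-cost form of symmetry restoration: the content of the quasi-polynomial
/ polynomial restoration statements of route ProofCarryingSymmetry (`RestorationQP`,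
`StabilityOfProvableSymmetry`) is exactly the uniformity of their bounds in `n`. [folklore] -/
theorem exists_isSymmetric_perm_of_rename_eval_eq {𝔽 : Type u} [Field 𝔽] [CharZero 𝔽] {n : ℕ}
    (C : PICircuit 𝔽 (Fin n × Fin n))
    (hC : ∀ σ : Equiv.Perm (Fin n),
      MvPolynomial.rename (fun x : Fin n × Fin n => σ • x) C.eval = C.eval) :
    ∃ (G : Type u) (_ : Fintype G) (D : LabelledArithCircuit 𝔽 (Fin n × Fin n) Unit G),
      D.IsSymmetric (Equiv.Perm (Fin n)) ∧ D.eval (D.output ()) = C.eval ∧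
      Fintype.card G ≤ n ^ 2 + (2 * n.factorial + 1) * C.size + 5 := by
  have hcard : Fintype.card (Equiv.Perm (Fin n)) = n.factorial := by
    rw [Fintype.card_perm, Fintype.card_fin]
  have hne : (n.factorial : 𝔽) ≠ 0 := by exact_mod_cast n.factorial_ne_zero
  obtain ⟨G, hG, D, h1, h2, h3⟩ := C.exists_isSymmetric_of_rename_eval_eq (Γ := Equiv.Perm (Fin n))
    ((n.factorial : 𝔽)⁻¹) (by rw [hcard, mul_inv_cancel₀ hne]) hC
  refine ⟨G, hG, D, h1, h2, ?_⟩
  rw [hcard, Fintype.card_prod, Fintype.card_fin, ← sq] at h3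
  exact h3

end PICircuit

end Literature.Computability.AlgebraicComplexity
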